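import Summits.QuantumFields.YangMills.Theorems.ParabolicTrajectoryLatticeGapOnTrajectoryDecayInterface
import Summits.QuantumFields.YangMills.Theorems.ParabolicTrajectoryLatticeGapOnTrajectorySparseDefectEngineSanity
import Summits.QuantumFields.YangMills.Theorems.LatticeGapOnTrajectory.Negative.Residuals
import Summits.QuantumFields.YangMills.Theorems.ParabolicTrajectoryLatticeGapOnTrajectoryStubOddRPCrossTilt
import Summits.QuantumFields.YangMills.Theorems.ParabolicTrajectoryLatticeGapOnTrajectoryStubTiltChessboardStep
import Summits.QuantumFields.YangMills.Theorems.ParabolicTrajectoryLatticeGapOnTrajectoryStubTiltChessboard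
import Summits.QuantumFields.YangMills.Theorems.ParabolicTrajectoryLatticeGapOnTrajectoryStubLargeFieldSparseOfChessboard
import Summits.QuantumFields.YangMills.Theorems.ParabolicTrajectoryLatticeGapOnTrajectoryLargeFieldSparse
import Summits.QuantumFields.YangMills.Theorems.ParabolicTrajectoryLatticeGapOnTrajectorySlabClusteringTorusKernels
import Summits.QuantumFields.YangMills.Theorems.ParabolicTrajectoryLatticeGapOnTrajectoryStubTorusRange
import Summits.QuantumFields.YangMills.Theorems.ParabolicTrajectoryLatticeGapOnTrajectoryStubTorusCrude
import Summits.QuantumFields.YangMills.Theorems.ParabolicTrajectoryLatticeGapOnTrajectoryStubSparseUnderOfLargeField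
import Summits.QuantumFields.YangMills.Theorems.ParabolicTrajectoryLatticeGapOnTrajectoryStubLargeFieldCountEvent
import Summits.QuantumFields.YangMills.Theorems.ParabolicTrajectoryLatticeGapOnTrajectorySparseDefectCoreDefs
import Summits.QuantumFields.YangMills.Theorems.ParabolicTrajectoryLatticeGapOnTrajectorySparseDefectFamiliesDefs
import Summits.QuantumFields.YangMills.Theorems.ParabolicTrajectoryLatticeGapOnTrajectoryStubRoughCentreCrude
import Summits.QuantumFields.YangMills.Theorems.ParabolicTrajectoryLatticeGapOnTrajectoryStubHereditaryOfCondFamilies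
import Literature.Probability.LatticeModels.DobrushinShlosmanWindowDusting

/-!
# Line `sparse-defect-orbit-window` — crux-plan skeleton (planner, round 2, 2026-08-17)

Crux `Summit.QuantumFields.YangMills.Theses.ParabolicTrajectory.LatticeGapOnTrajectory`
(stmt-QuantumFields-10523, conjunct (B) of route `ParabolicTrajectory`, rev 7 = text of rev 4).
Card `Cruxes/LatticeGapOnTrajectory/Ideas/sparse-defect-orbit-window.md` (crux-ideate r2 k5);
triage r2: pass 2–1 (TRIAGE-r2-1 pass, r2-2 fail on the filed-text rider C0 only, r2-3 deciding pass),
`merge ≈ orbit-kantorovich-finite-size` (one line family: the one-scale orbit–Kantorovich window on the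
FINE Wilson torus specification; this line = the typical-data reshape R3 of that family's physics stub
+ an annealed engine). Line card: `Lines/sparse-defect-orbit-window.md`.

## Current shape (lead c8, 2026-08-17): 4 `sorry`s = 4 registered stubs
`stub_typicalCoreFamilies` (THE PHYSICS, family form, held by the lead) · `stub_sparseDefectEngine` (standing
promote-stub) · `stub_volume`, `stub_symmetrise` (filed-text residuals, standing stub-misstated). Everything
G-blind is LANDED: large-field sparseness (a4: p138378 p139208 p139040 p138284 p138599 p139523), window plumbing
(R) p140790, (C) p140789, (U) p140953, (M) p140797, CoreDefs p141179 (`TypicalCoreAlongP`,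
`typicalOrbitWindowsAlongP_of_core`), FamiliesDefs p141592 (`familyGood`, `TypicalCoreFamiliesAlongP`,
`typicalCoreAlongP_of_families`), tools (T1) p142146, (T2) p142110. Chain:
`stub_typicalCoreFamilies ⟹ stub_typicalCore ⟹ stub_typicalOrbitWindows ⟹ (engine) Sub₁ ⟹ (residuals) crux`.
The planner's original shape is kept below for the record.

## Shape (5 registered stubs + kernel-checked composition)

* `stub_largeFieldSparseness` — G-GENERAL LARGE-FIELD SPARSENESS under Wilson's torus measure on odd
  tori (`LargeFieldSparse r`): for every `ε₀ > 0` there are `c > 0`, `b₀`, `S₀` with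
  `μ_{β,2S+1}(every plaquette of X is ε₀-large) ≤ e^{−c β |X|}` for all `β ≥ b₀`, `S ≥ S₀` and all
  finite plaquette sets `X`. NEW as a registered stub (triage r2-1 (c), r2-2 sharpen (1), r2-3
  sharpen (2)): provable now, M/L — Chebyshev tilt `∏ e^{t(s_p−ε₀)}` with `t ≤ β` (TILT FORM: net
  plaquette couplings stay in `[0, β]`, which is exactly where the odd-torus chessboard survives —
  the naive plaquette chessboard for vanishing functionals is FALSE on odd tori,
  `FemtoCurvatureTwoPoint/Negative/ChessboardOddTorus.plaquetteChessboard_allTori_false`), the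
  Z-form chessboard `Z({β_p}) ≤ ∏_p Z(β_p)^{1/|P|}` from `wilsonExpectation_oddReflectionPositive`
  by the FILS maximisation on odd cycles (tree pattern `oddCycle_chessboard`), and the free-energy
  bound `−log Z_β ≤ o(β)·|P|` uniform in the torus, which needs ONLY positivity of Haar measure on
  open balls (no `dim G`, no `log β`, no Lie structure) — hence the rate form `e^{−cβ|X|}` rather than
  the card's `e^{−(βε₀/16 − C(1+log β))|X|}`.
* `stub_typicalOrbitWindows` — THE PHYSICS (open-problem strength = Sub₁ of the split; the only stub
  consuming `IsCompactSimpleLieGroup`, `β_k → ∞` and the tuning; Disproof §5 placement honoured):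
  the typical orbit–Kantorovich package `TypicalOrbitWindowsAlongP r M sch n` (landed Defs p127447)
  along every tuned scheme, NOW WITH `LargeFieldSparse r` AS A HYPOTHESIS (the `SparseUnder` clause of
  the package for count-type good sets is large-field sparseness + a union bound; what remains is
  `contract` on good shells, `sum_le`, the crude clause — dischargeable from TorusKernels p121572 —
  `HereditarySparse` (conditional large-field suppression given good shells: PHYSICS, not a
  chessboard output, r2-1 (c)) and `RoughCentreBound`). Intended instance (card + triage numbers):
  good sets = SUB-BLOCK large-field counts at scale `ℓ(ε₀)` (whole-cell counts do not see
  codimension-≥1 defects, r2-1 (b)), resolution `α_k = λ/β_k` (R1), `q_k + 1 ≥ max(2e·mean, K log₂ D_k)`.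
* `stub_sparseDefectEngine` — THE ANNEALED SPARSE-DEFECT ENGINE (`SparseDefectEngine`, landed Defs;
  G-blind finite probability; CRUX-SIZED, standing `promote-stub` by lead c4, concurred c5/c7 and by
  all three r2 triagers; toy evidence FOR the statement: 1-d `ρ ≤ 3.4h` (c4), 2-d j021373/j021397/
  j021403 (r2-3: no admissible slow specification once the all-`X` joint sparseness is enforced);
  sanity `kREngine_of_sparseDefectEngine` p128070: it implies the landed sup-form engine).
* `stub_volume`, `stub_symmetrise` — the two RESIDUALS of the FILED text (shared registered
  signatures `Split.VolumeGrowthOnTrajectory` / `Split.SymmetrisationOnTrajectory`, identical in the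
  okfs, step-scaling and SketchIdeator5-r2 skeletons; certified `stub-misstated` by eleven leads with
  landed negatives `Negative/Residuals.lean` p132883 and `Negative/TransferObstruction.lean` p114724;
  NOT claimed; NOT refuted — a `¬` of either exhibits the `∃`-core of (S),
  `Negative.exists_tuned_of_not_volumeGrowthOnTrajectory` / `…_symmetrisationOnTrajectory`, checked
  below). They are registered ONLY so that the composition concludes the filed decl by name; the line
  is LIVE under the restatement (`Split.LatticeGapOnTrajectoryRV` / `--split … --into Lat Vol Sym`),
  for which `latticeGapOnTrajectoryLat_of_line` / `latticeGapOnTrajectoryRV_of_line` below are the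
  compositions (closed modulo stubs 1–3).

Composition: `LatticeGapOnTrajectory_of` (no hypotheses; concludes the crux BY NAME; `sorry` only
inside the five stubs) = `Split.latticeGapOnTrajectory_of_subs` (p124272) ∘
`latticeGapOnTrajectoryLat_of_typical` (DecayInterface p128295: engine + typical package ⇒ Sub₁ through
`stub_decayOfTypicalWindows` p127716, `stub_gapOfDecay` p127898, `stub_slabClusteringOfDecay` p128168).

## Disproof.lean (v4.3, RESISTS) — what this skeleton answers to
§2 `concl_iff_split`: lattice half and transfer half closed at independent rates (glued by `min` inside
the landed interface). §3 `tunedWitnessExists_of_not_crux`: no stub here is Lean-refutable without a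
tuned witness EXCEPT stubs 1 and 3, which quantify over all tori / all finite specifications and are
where a disprover should aim (stub 1: a single `(G, β, S, X)` violating the rate; stub 3: a finite
specification with slow decay — r2-3's sweep found none). §4b/4c (`hasLatticeMassGap_of_zero_coupling`,
`uniformSlabClustering_of_zero_coupling`): at `β = 0` stub 1's bound reads `≤ 1` (consistent), windows
contract trivially, sparseness is vacuous (`SparseUnder … univ`) — the currency is not junk-contradictory;
`β_k → ∞` excludes the point. §5 `WithoutSimple`: simplicity enters at stub 2 only (typical `U(1)` data
transmit the Ad-invariant constant-curvature mode, drefute gen-2 §3(c) — restricting to typical data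
does NOT smuggle the abelian case); `WithoutTuning`/`WithoutBeta`: the cell scale `t(θ)·M^{n_k}` and
the rarity thresholds exist only along tuned weak-coupling sequences. §6(i): `Δ = κ/t(θ)`, no θ-uniform
rate; §6(ii): constants `(Σδ_f)(Σδ_g)`-dependent. Negative notes honoured: gen-1 R4 (no additive small
right-hand side: bad windows get the MULTIPLICATIVE free pass `A_k`); gen-2 face modes (same weight,
same resolution as okfs R1). Landed Negative lemmas `ArcCertificateStrength`, `IdleCertificate`,
`JunkCharts`, `TransferObstruction`, `Residuals`: no stub posits a `BalabanBanachStep`, a certificate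
or a per-pair transfer; the residual stubs carry the tuning hypothesis, so
`Negative.volumeGrowth_false_without_tuning` (tuning DELETED) does not instantiate them.
-/

set_option autoImplicit false

noncomputable section

namespace Summit.QuantumFields.YangMills.Cruxes.LatticeGapOnTrajectory.SparseDefectOrbitWindow

open scoped BigOperators Topology ENNReal ProbabilityTheory ComplexOrder
open Filter MeasureTheory
open Literature.Probability.LatticeModels (Specification IsSpecification IsGibbsMeasure glueWith)
open Literature.MathematicalPhysics.QuantumFieldTheory
open Summit.QuantumFields.YangMills.Theses.ParabolicTrajectory
open Summit.QuantumFields.YangMills.Cruxes.LatticeGapOnTrajectory.OrbitKantorovichFiniteSize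

/-! ## §0 Vocabulary of the first stub (large-field events) -/

section LargeField

variable {G : Type} [Group G] [TopologicalSpace G]

/-- **The large-field event of a plaquette set `X`** on the torus of side `L`: every plaquette of `X`
has Wilson plaquette energy `s_p(U) = N − Re tr ρ(U_p)` at least `ε₀` (tree convention of
`wilsonAction`: `s_p ∈ [0, 2N]`, flat plaquette `s_p = 0`). -/
def largeFieldSet (r : LatticeRep G) {L : ℕ} (ε₀ : ℝ) (X : Finset (Plaquette 4 L)) :
    Set (GaugeConfig 4 L G) :=
  {U | ∀ p ∈ X, ε₀ ≤ (r.N : ℝ) - (r.ρ (plaquetteHolonomy U p.1 p.2.1.1 p.2.1.2)).trace.re}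

variable [IsTopologicalGroup G] [CompactSpace G] [MeasurableSpace G] [BorelSpace G]

/-- **Large-field sparseness under Wilson's torus measure (`LargeFieldSparse r`).** For every
threshold `ε₀ > 0` there are a rate `c > 0`, a coupling `b₀` and a size `S₀` such that for all
`β ≥ b₀`, all odd tori of side `2S+1` with `S ≥ S₀` and ALL finite plaquette sets `X`,
`μ_{β, 2S+1}(every p ∈ X is ε₀-large) ≤ exp(−c β |X|)`: a prescribed set of large plaquettes is
jointly exponentially rare in `β`, per plaquette, uniformly in the volume. (Bałaban's large-field
suppression, CMP 122 (1989) (0.35)–(0.37), in its classical chessboard form; `G`-general — the only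
group input is positivity of Haar measure on open sets.) -/
def LargeFieldSparse (r : LatticeRep G) : Prop :=
  ∀ ε₀ : ℝ, 0 < ε₀ → ∃ (c b₀ : ℝ) (S₀ : ℕ), 0 < c ∧ ∀ β : ℝ, b₀ ≤ β → ∀ S : ℕ, S₀ ≤ S →
    ∀ X : Finset (Plaquette 4 (2 * S + 1)),
      wilsonMeasure (d := 4) (L := 2 * S + 1) r.ρ β (largeFieldSet r ε₀ X) ≤
        ENNReal.ofReal (Real.exp (-(c * β * X.card)))

omit [IsTopologicalGroup G] [CompactSpace G] [MeasurableSpace G] [BorelSpace G] in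
/-- Degenerate instance: the empty plaquette set carries the trivial bound `1` (the event is everything
and `exp 0 = 1`), so `LargeFieldSparse` constrains only non-empty `X`. -/
theorem largeFieldSet_empty (r : LatticeRep G) {L : ℕ} (ε₀ : ℝ) :
    largeFieldSet r ε₀ (∅ : Finset (Plaquette 4 L)) = Set.univ := by
  ext U; simp [largeFieldSet]

end LargeField

/-! ## §1 The five registered stubs -/

/-! ## §1a The large-field machinery (lead a4 reshape of `stub_largeFieldSparseness`, 2026-08-17)

`stub_largeFieldSparseness` (planner: ONE M/L stub) is reshaped at the skeleton level into four
registered, definition-free stubs whose composition `largeFieldSparseness` is kernel-checked below: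

* (A) `stub_oddRPCrossTilt` — Osterwalder–Seiler positivity on the ODD torus WITH A CROSSING TILT:
  the covariant mechanism of `wilsonExpectation_nonneg_of_oddCovariant` re-run with per-plaquette
  crossing couplings `β − t_p ∈ [0, β]` (the Gram expansion `sum_oCoeff_mul_conj` with coefficients
  `√((β − t_p)/2)`); this is exactly the sign condition under which the odd-torus chessboard survives
  (`plaquetteChessboard_allTori_false` kills it for general non-negative plaquette functionals).
* (B) `stub_tiltChessboardStep` — the ONE-DIRECTION (time) chessboard for exponential tilt functionals
  of ONE orientation class on the odd four-torus, from (A): `Φ(c)^{2S+1} ≤ ∏ₛ Φ(c ∘ [x₀ := s])`,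
  `Φ(c) = E_β exp(−∑ₓ c(x) Re tr ρ(U_{(x,o)}))`, `0 ≤ c ≤ β`; 1-d core = landed `OddCycle.chessboard`
  (FILS maximisation on the odd cycle), Schwarz step = (A) tested on `a F₁ + b F₂` (pattern of
  `…ChessboardStubColumnChessboard.schwarz`), rotation = `wilsonMeasure_map_torusConfigShift`; for a
  class containing the time direction the reflection used is `t ↦ 2 − t` = `θ` conjugated by the
  translation `S + 1` (its crossing layer is the link layer `[S+1, S+2]`, index `S + 1 ∈ cPlus`).
* (C) `stub_tiltChessboard` — all four directions from (B) by the axis symmetry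
  `wilsonMeasure_map_configPerm` + `plaquetteHolonomy_configPerm`/`plaquetteHolonomy_swap` and a
  fourfold iteration: `Φ(c)^{(2S+1)⁴} ≤ ∏_y Φ(const (c y))`.
* (D) `stub_largeFieldSparse_of_chessboard` — Chebyshev assembly: pigeonhole to the largest
  orientation class (`|X ∩ P_o| ≥ |X|/6`, monotonicity of the event), tilt `t = β`,
  `E_β e^{β ∑_{P_o} s} ≤ e^{−βN L⁴}/Z_L(β)` (switching a class off costs at most the free energy) and
  the LANDED crude free-energy bound `exp_mul_pow_le_partitionFunction_toReal`
  (`Z_L(β) ≥ e^{−48βδ²L⁴}(C₁δ^D)^{4L⁴}`, Haar small-ball positivity), `48δ² = ε₀/2`: rate `c = ε₀/24`.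
-/

/-! ### Stubs (A)–(D): LANDED (wave 1 of lead a4, 2026-08-17) — imported above
* (A) `stub_oddRPCrossTilt` — `Theorems/ParabolicTrajectoryLatticeGapOnTrajectoryStubOddRPCrossTilt.lean`, p138378;
* (B) `stub_tiltChessboardStep` — `…StubTiltChessboardStep.lean`, p139208 (+ `…StubTiltChessboardStepAux.lean`, p139040,
  registered helper `schwarz_profiles`);
* (C) `stub_tiltChessboard` — `…StubTiltChessboard.lean`, p138284;
* (D) `stub_largeFieldSparse_of_chessboard` — `…StubLargeFieldSparseOfChessboard.lean`, p138599.
All ACCEPTED, axioms {propext, Classical.choice, Quot.sound}. -/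

/-- **Large-field sparseness for every compact `G`** — the planner's `stub_largeFieldSparseness`,
now PROVED (stubs (A)–(D) landed, wave 1): `LargeFieldSparse r` unfolds (definitionally) to the
conclusion of (D), fed by (C) ∘ (B) ∘ (A). -/
theorem largeFieldSparseness :
    ∀ (G : Type) [Group G] [TopologicalSpace G] [IsTopologicalGroup G] [CompactSpace G]
      [MeasurableSpace G] [BorelSpace G] (r : LatticeRep G), LargeFieldSparse r :=
  fun G _ _ _ _ _ _ r =>
    stub_largeFieldSparse_of_chessboard (stub_tiltChessboard (stub_tiltChessboardStep stub_oddRPCrossTilt))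
      G r

/-- **stub_typicalOrbitWindows** — THE PHYSICS (open; the line's bet; = Sub₁ in typical-window
currency; hardest stub). Along every tuned `M`-adic weak-coupling Wilson scheme of a compact simple `G`,
GIVEN large-field sparseness of Wilson's torus measures (stub 1), the typical orbit–Kantorovich package
`TypicalOrbitWindowsAlongP r M sch n` holds: a cell scale `t`, radius `n₀`, ratio `γ₀ < 1`, resolution
`α_k > 0` with the polynomial clause, crude constants `A_k`, sparseness levels `ε_k` with
`ε_k (1 + A_k) → 0`, rough-centre constants, such that eventually in `k`, on every torus `S ≥ L_k` and
every frame family of scale `t·M^{n_k}`, Wilson's torus specification carries `IsTypicalKRWindow` for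
SOME cell-local good events and SOME profile, with hereditary and state joint `ε_k`-sparseness of bad
cells, and the rough-centre bound. INTENDED INSTANCE (card §Lever + triage r2-1 sharpen (1), r2-3
sharpen (2)): `good y` = "every sub-block of side `ℓ` of cell `y` has at most `q` plaquettes with
`s_p ≥ ε₀`" with `ℓ = ℓ(ε₀, β_k)` in the window `[(0.24(K+5)β)^{1/4} e^{ε₀β/4}, e^{ε₀β}/4.4]` (non-empty
at large `β`; whole-cell counts are blind to codimension-≥1 defects — hot walls contribute `O(ℓ³)`
against a slack `O(ℓ⁴ e^{−ε₀β})`), `α_k = λ/β_k` (drefute R1; makes the crude constant β-free,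
`A_k ≍ λ · 7680 t⁴ M^{4n_k}` by `abs_windowAvg_sub_le_orbitWeight_frame`), thresholds
`q + 1 ≥ max(2e·mean count, (K+5) log₂ D_k)`; then `SparseUnder` follows from the hypothesis
`LargeFieldSparse r` by the union bound over sub-blocks and `(q+1)`-subsets (bad cells of distinct
cells use disjoint plaquette sets, so the joint bound is `ε_k^{|X|}`), the crude clause and the kernel
regularity fields from TorusKernels p121572, and the GENUINE PHYSICS is: `contract` with received sum
`γ₀ < 1` for shell data in the good sets (the bulk influence profile of the weak-coupling vacuum at the
physical cell scale `t(θ)` — the mass gap in certificate form, restricted to ν-typical data), and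
`HereditarySparse` (large fields stay rare under the window kernels given good shells: staple alignment
by lattice Bianchi + one-link Laplace concentration). Disproof §5: the only stub using simplicity,
`β_k → ∞`, the tuning. Weaker than okfs's registered `stub_orbitKantorovichWindow` in `contract`
(`IsTypicalKRWindow.of_isKRWindow`), stronger in asking hereditary sparseness; FALLBACK reshape = okfs's
sup package `Split.OrbitKRWindowsAlongP` with the landed engine (`Split.latticeGapOnTrajectoryLat_of_windowsP`).

LEAD c8 RESHAPE (2026-08-17): this former stub is now a THEOREM, `stub_typicalOrbitWindows` below,
assembled from the G-blind PLUMBING stubs of §1b (weight locality, finite range, crude clause) and the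
PHYSICS CORE stub `stub_typicalCore` (§1b), by `typicalOrbitWindowsAlongP_of_core`. -/
example : True := trivial

/-! ## §1b Lead c8 reshape of `stub_typicalOrbitWindows` (2026-08-17): G-blind plumbing vs physics

`TypicalOrbitWindowsAlongP` asks, torus by torus and frame family by frame family, for the structure
`IsTypicalKRWindow (cellOf q) (orbitWeight r α q) (torusYM …) 1 n₀ γ₀ kp good A` plus three sparseness /
rough-centre clauses. Of the eleven fields of `IsTypicalKRWindow`, SEVEN are G-blind facts about Wilson's
torus specification read in the capped orbit weight on axis frames and hold for EVERY `β`, `α > 0`, every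
torus and every frame family: `w_nonneg`, `w_le` (cap `R = 1`), `w_local` (stub (W)), `A_nonneg`, `range`
(stub (R): finite range ONE cell, from `dependsOn_windowAvg_torusYM` + the one-step geometry of frames),
`crude` (stub (C): the landed total-variation bound `abs_windowAvg_sub_le_orbitWeight_frame` p121572 after
recentring `f` by one-cell interpolation, `abs_sub_le_sum_cells`; explicit constant
`A(β, α, b) = 2(1 + 2e²|β|α·7680 b⁴)` at frame scale `b = t·M^{n_k}` — a `k`-SEQUENCE, as the package
demands). The remaining four (`k_nonneg`, `good_meas`, `good_local`, `contract`, `sum_le`) together with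
`HereditarySparse`, `SparseUnder`, `RoughCentreBound` and the parameter clause `ε_k (1 + A_k) → 0` AT THE
G-BLIND `A_k` form the PHYSICS CORE `TypicalCoreAlongP` (stub `stub_typicalCore`, held by the lead). Two
further G-blind TOOLS for whoever proves the core with count-type good events are registered as stubs
(U) `stub_sparseUnderOfLargeField` (joint sparseness under Wilson's measure from `LargeFieldSparse` by the
union bound over prescribed covering families of plaquette sets, disjoint across cells:
`ε = J·e^{−cβm}`) and (M) `stub_largeFieldCountEvent` (the event "at least `m` of the plaquettes of `P`
are `ε₀`-large" is measurable and read on the cell carrying `P`). Composition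
`typicalOrbitWindowsAlongP_of_core` is kernel-checked below; `stub_typicalOrbitWindows` keeps its
registered name and signature and is now proved from (W)(R)(C) + core. -/

/-! ### Plumbing (W) and the physics-core vocabulary: LANDED (lead c8, 2026-08-17) — imported above
`crudeConst`, `crudeConst_nonneg`, `orbitWeight_local` (stub (W)), the physics core `TypicalCoreAlongP`
and the kernel-checked composition `typicalOrbitWindowsAlongP_of_core` (core + (W)(R)(C) ⇒
`TypicalOrbitWindowsAlongP`): `Theorems/ParabolicTrajectoryLatticeGapOnTrajectorySparseDefectCoreDefs.lean`,
p141179 (ACCEPTED). -/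

/-! ### Stubs (R), (C), (U), (M): LANDED (wave 1 of lead c8, 2026-08-17) — imported above
* (R) `stub_torusRange` — finite range ONE cell of Wilson's torus specification on frame windows
  (`SlabClustering.dependsOn_windowAvg_torusYM` + one-step frame geometry
  `StubTorusRange.cdist_siteCell_le_one` / `plaquette_links_near`):
  `Theorems/ParabolicTrajectoryLatticeGapOnTrajectoryStubTorusRange.lean`, p140790;
* (C) `stub_torusCrude` — the crude total-variation clause with the explicit constant
  `2(1 + 2e²|β|α·7680 b⁴)·(Σ_{W(c)} δ)` (recentring `StubTorusCrude.windowAvg_sub_const`, window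
  interpolation `StubTorusCrude.abs_sub_le_sum_filter`, `abs_windowAvg_sub_le_orbitWeight_frame`):
  `…StubTorusCrude.lean`, p140789;
* (U) `stub_sparseUnderOfLargeField` — `SparseUnder μ_β good (J e^{−cβm})` from the body of
  `LargeFieldSparse` by the union bound over choice functions (`StubSparseUnderOfLargeField.
  mul_card_le_card_biUnion`, `exp_neg_mul_le_pow`): `…StubSparseUnderOfLargeField.lean`, p140953;
* (M) `stub_largeFieldCountEvent` — the count event `∃ Y ⊆ P, m ≤ |Y| ∧ ∀ p ∈ Y, large` is measurable
  and read on the cell carrying `P` (`StubLargeFieldCountEvent.measurableSet_count`,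
  `plaquetteHolonomy_congr_of_cell`): `…StubLargeFieldCountEvent.lean`, p140797.
All ACCEPTED, axioms {propext, Classical.choice, Quot.sound}; registered signatures unchanged (the
skeleton now uses the tree theorems of the same fully-qualified names). -/


/-! ## §1c G-blind TOOLS for the family core (lead c8, wave 2, 2026-08-17) — registered stubs

Two further G-blind statements a prover of `stub_typicalCoreFamilies` needs, registered so that they
land as `--supports` helpers (they are not links of the composition chain):
* (T1) `stub_roughCentreCrude` — `RoughCentreBound` holds at EVERY coupling, resolution `α > 0`,
  radius and support size with the CRUDE constant `K = (2n₀+3)⁴ · crudeConst β α b` on axis frames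
  of scale `b`: the window kernel ignores the boundary datum inside the window (glueing), cells
  beyond the shell do not influence it (finite range, stub (R) p140790), and a shell cell moves it by
  at most `2B(1 + 2e²|β|α·7680 b⁴)·w_y` (TV-Lipschitz, `abs_windowAvg_sub_le_orbitWeight_frame`);
  the shell has at most `(2n₀+3)⁴` cells. CONSEQUENCE: the physics content of `RoughCentreBound` in
  the core is exactly the `k`-UNIFORMITY of `K_s` at the physics resolution `α_k` (at
  `α_k ≤ λ/(|β_k| b_k⁴)` it is free, but there the orbit weight is total-variation-like and `contract`
  is hopeless at weak coupling — NOTES §Physics audit).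
* (T2) `stub_hereditaryOfCondFamilies` — the CONDITIONAL union bound: hereditary joint sparseness of
  family-type bad cells under the window kernels, `HereditarySparse … (familyGood r ε₀ P) (J e^{−κ m})`,
  from a conditional large-field bound for prescribed families given family-good shells,
  `γ_{W(c)}(every plaquette of the chosen families of the cells of X is ε₀-large | ω) ≤ e^{−κ m |X|}`
  for every choice function — the kernel analogue of stub (U); it isolates the physics of
  `HereditarySparse` into that conditional estimate (which, by the flux-focusing FINDING recorded at `stub_typicalCoreFamilies`,
  fails for every cell-local one-threshold plaquette event except possibly all-orientation families). -/

/-! ### Stubs (T1), (T2): LANDED (wave 2 of lead c8, 2026-08-17) — imported above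
* (T1) `stub_roughCentreCrude` — `…StubRoughCentreCrude.lean`, p142146 (helpers `StubRoughCentreCrude.torusYM_congr`
  — the kernel ignores the boundary datum inside `Λ` —, `card_shell_le`);
* (T2) `stub_hereditaryOfCondFamilies` — `…StubHereditaryOfCondFamilies.lean`, p142110.
Both ACCEPTED, axioms {propext, Classical.choice, Quot.sound}. -/

/-- **Stub `stub_typicalCoreFamilies`** — THE PHYSICS CORE IN FAMILY FORM (open; the line's bet;
held by the lead; = Sub₁ in typical-window currency with every G-blind field removed AND joint
sparseness under Wilson's measure peeled off: lead c8, second reshape, 2026-08-17). Along every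
tuned `M`-adic weak-coupling Wilson scheme of a compact simple `G`: `TypicalCoreFamiliesAlongP r M sch n`
(FamiliesDefs): a threshold `ε₀ > 0`, family counts/sizes `J_k, m_k` with
`∀ c > 0, J_k e^{−cβ_k m_k}(1 + A_k) → 0`, hereditary levels `ε_k (1 + A_k) → 0` at the G-blind
`A_k = crudeConst β_k α_k (t·M^{n_k})`, and on every torus / frame family SOME cell-carried plaquette
families `P x j` (`|P x j| ≥ m_k`) and SOME profile `kp ≥ 0` such that, for the family-type good
events `familyGood r ε₀ P` ("no prescribed family of the cell is entirely `ε₀`-large"): `contract`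
(Dobrushin–Shlosman contraction for shell-good data — the mass gap in one-scale certificate form),
`sum_le`, `HereditarySparse` (conditional large-field suppression given good shells) and
`RoughCentreBound` (UV decoupling). Disproof §5 placement: the only stub consuming
`IsCompactSimpleLieGroup`, `β_k → ∞` and the tuning. FINDING (lead c8, boundary FLUX FOCUSING; evidence `FORCING.md` + `bounds_pure.py` on the crux item): in the
β → ∞ small-field limit the window kernel concentrates on the harmonic extension of the shell data, and harmonic
extension AMPLIFIES: shell data with every plaquette field `≤ 1` force interior plaquette fields up to `c₂ ≈ 2.2`
(d = 3 bulk, certified [2.15, 2.20] at the centre of 6³) and `≥ 1.3` (certified, centre of 4⁴; `≥ 1.9` near its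
boundary) in ONE chosen orientation — a window-scale bulk effect (flux through half the boundary crosses the
mid-section), energies × c₂². Hence shell data good at level `0.9 ε₀` make interior cells bad with conditional
probability → 1 for every count / single-orientation-family / energy-density instance of `familyGood`:
`HereditarySparse` FAILS there (this supersedes the first-cycle note that volume-proportional thresholds suffice).
Only ALL-ORIENTATION families (a cell is bad iff some sub-block has EVERY plaquette large) are protected, through the
JOINT amplification (≈ 1.1–1.3 in d = 3; marginal in d = 4) — and for them "good" tolerates maximal single-orientation
fields, so `contract` is as hard as for okfs's sup-form package. The typical-data lever therefore cannot be carried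
by a cell-local one-threshold plaquette event; a successor needs window hypotheses annealed in ω (non-local shell
events) or an explicit multiscale background/fluctuation split. The stub below is NOT refuted (vacuous-goodness
corner = sup form; no tuned witness, Disproof §3); its distinguishing content is. -/
theorem stub_typicalCoreFamilies :
    ∀ (G : Type) [Group G] [TopologicalSpace G] [IsTopologicalGroup G] [CompactSpace G]
      [MeasurableSpace G] [BorelSpace G], IsCompactSimpleLieGroup G →
      ∀ (r : LatticeRep G) (M : ℕ) (θ : ℝ) (sch : SpeciesScheme (YMSpecies G)) (n : ℕ → ℕ),
        2 ≤ M → 0 < θ → (∀ k, sch.a k = ((M : ℝ) ^ n k)⁻¹) → Tendsto sch.β atTop atTop →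
        Tendsto (fun k => ((M : ℝ) ^ n k) ^ 8 *
            latticeConnectedCorr r.ρ (sch.β k) (sch.side k) r.curvature.F r.curvature.F (M ^ n k))
          atTop (𝓝 θ) →
        TypicalCoreFamiliesAlongP r M sch n := by
  sorry

/-- **`stub_typicalCore`** — the registered physics stub of the first c8 reshape, NOW A THEOREM of the
second: family core (`stub_typicalCoreFamilies`) + `largeFieldSparse` + (U) + (M) through
`typicalCoreAlongP_of_families` (FamiliesDefs). Same name, same signature (the hypothesis
`LargeFieldSparse r` is no longer needed — it is a tree theorem for every compact `G` — and is ignored). -/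
theorem stub_typicalCore :
    ∀ (G : Type) [Group G] [TopologicalSpace G] [IsTopologicalGroup G] [CompactSpace G]
      [MeasurableSpace G] [BorelSpace G], IsCompactSimpleLieGroup G →
      ∀ (r : LatticeRep G), LargeFieldSparse r →
      ∀ (M : ℕ) (θ : ℝ) (sch : SpeciesScheme (YMSpecies G)) (n : ℕ → ℕ),
        2 ≤ M → 0 < θ → (∀ k, sch.a k = ((M : ℝ) ^ n k)⁻¹) → Tendsto sch.β atTop atTop →
        Tendsto (fun k => ((M : ℝ) ^ n k) ^ 8 *
            latticeConnectedCorr r.ρ (sch.β k) (sch.side k) r.curvature.F r.curvature.F (M ^ n k))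
          atTop (𝓝 θ) →
        TypicalCoreAlongP r M sch n :=
  fun G _ _ _ _ _ _ hG r _ M θ sch n hM hθ hshape hβ htune =>
    typicalCoreAlongP_of_families r hβ (stub_typicalCoreFamilies G hG r M θ sch n hM hθ hshape hβ htune)

/-- **`stub_typicalOrbitWindows`** — the registered physics stub of the planner/a4 skeleton, NOW A
THEOREM of the reshape: physics core (`stub_typicalCore`) + plumbing (W)(R)(C) through
`typicalOrbitWindowsAlongP_of_core`. Same name, same signature. -/
theorem stub_typicalOrbitWindows :
    ∀ (G : Type) [Group G] [TopologicalSpace G] [IsTopologicalGroup G] [CompactSpace G]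
      [MeasurableSpace G] [BorelSpace G], IsCompactSimpleLieGroup G →
      ∀ (r : LatticeRep G), LargeFieldSparse r →
      ∀ (M : ℕ) (θ : ℝ) (sch : SpeciesScheme (YMSpecies G)) (n : ℕ → ℕ),
        2 ≤ M → 0 < θ → (∀ k, sch.a k = ((M : ℝ) ^ n k)⁻¹) → Tendsto sch.β atTop atTop →
        Tendsto (fun k => ((M : ℝ) ^ n k) ^ 8 *
            latticeConnectedCorr r.ρ (sch.β k) (sch.side k) r.curvature.F r.curvature.F (M ^ n k))
          atTop (𝓝 θ) →
        TypicalOrbitWindowsAlongP r M sch n :=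
  fun G _ _ _ _ _ _ hG r hLF M θ sch n hM hθ hshape hβ htune =>
    typicalOrbitWindowsAlongP_of_core r (stub_typicalCore G hG r hLF M θ sch n hM hθ hshape hβ htune)

/-- **stub_sparseDefectEngine** — THE ANNEALED SPARSE-DEFECT DOBRUSHIN–SHLOSMAN ENGINE (open; G-blind
finite probability; crux-sized, standing `promote-stub`). Covariance decay `C₀ (Σδ_f)(Σδ_g) e^{−κD}` for
every finite specification carrying the typical KR window package `(good, A)` with hereditary joint
`ε`-sparseness and every Gibbs measure with joint `ε`-sparseness, once `ε (1 + A) ≤ c₀(n, γ₀, R)`.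
Quenched model: von Dreifus–Klein–Perez, CMP 170 (1995) 21. Two internal routes (card §Engine): (a)
annealed two-type disagreement-path expansion (van den Berg–Maes sequential coupling; bad steps paid
`√ε` by JOINT sparseness in each copy, no conditioning on the exploration past) — floor-free if the
adaptedness of the bad indicators along the exploration can be arranged; (b) stationary path coupling
of the frozen block heat bath (ε-floored weak mixing in ν-mean) + annealed multiscale bootstrap
`ε_{j+1} ≲ ℓ_{j+1}^8 ε_j²` removing the floor. Neither in print. -/
theorem stub_sparseDefectEngine : SparseDefectEngine := by
  sorry

/-- **stub_volume** — RESIDUAL (β) of the FILED text (= Sub₂ of the landed split; shared registered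
signature; NOT CLAIMED): the crux hypotheses see `L_k` only through `a_k L_k → ∞`, yet the transfer on
the scheme's own tori needs `a_k L_k / log(a_k⁻¹) → ∞`. Certified `stub-misstated` (eleven leads);
with the tuning deleted it is FALSE (`Negative.volumeGrowth_false_without_tuning`, SU(2), dyadic); a
formal `¬` exhibits a tuned sequence (`Negative.exists_tuned_of_not_volumeGrowthOnTrajectory`). The
restatement ADDS the clause to (B) (free for (S)) and this stub disappears. -/
theorem stub_volume : Split.VolumeGrowthOnTrajectory := by
  sorry

/-- **stub_symmetrise** — RESIDUAL (α) of the FILED text (= Sub₃ of the landed split; shared registered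
signature; NOT CLAIMED): from the transfer clause for reflection-symmetric polynomially bounded
witnesses to the filed clause over ALL `sch'`. Certified `stub-misstated`: the `T`-diagonal OS pair of a
species is the lattice OFF-diagonal pair `(sΘ, s)`, ratio `c_s/c_{sΘ}` free under `IsYangMillsFor`,
signed Laplace limits keep no rate (`Negative.perPair_clustering_does_not_transfer`, p114724); a formal
`¬` exhibits a tuned sequence (`Negative.exists_tuned_of_not_symmetrisationOnTrajectory`). The
restatement restricts `∀ sch'` (and lets (A) output a symmetric witness) and this stub disappears. -/
theorem stub_symmetrise : Split.SymmetrisationOnTrajectory := by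
  sorry

/-! ## §2 Checks against the landed negatives (the residuals are not instances of a refuted statement) -/

/-- Residual (β) is not Lean-refutable short of a tuned weak-coupling Wilson sequence (landed p132883). -/
example (h : ¬ Split.VolumeGrowthOnTrajectory) :=
  Summit.QuantumFields.YangMills.Theorems.LatticeGapOnTrajectory.Negative.exists_tuned_of_not_volumeGrowthOnTrajectory h

/-- Residual (α) likewise (landed p132883). -/
example (h : ¬ Split.SymmetrisationOnTrajectory) :=
  Summit.QuantumFields.YangMills.Theorems.LatticeGapOnTrajectory.Negative.exists_tuned_of_not_symmetrisationOnTrajectory h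

/-- The annealed engine is conservative over the PROVED sup-form engine (landed p128070): a
counterexample to stub 3 must use bad data essentially. -/
example : SparseDefectEngine → KREngine := kREngine_of_sparseDefectEngine

/-! ## §3 Compositions (kernel-checked; `sorry` only inside the stubs they invoke) -/

/-- **The typical package along every tuned scheme** from stubs 1 + 2: large-field sparseness is fed to
the physics stub. -/
theorem typicalWindows_along :
    ∀ (G : Type) [Group G] [TopologicalSpace G] [IsTopologicalGroup G] [CompactSpace G]
      [MeasurableSpace G] [BorelSpace G], IsCompactSimpleLieGroup G →
      ∀ (r : LatticeRep G) (M : ℕ) (θ : ℝ) (sch : SpeciesScheme (YMSpecies G)) (n : ℕ → ℕ),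
        2 ≤ M → 0 < θ → (∀ k, sch.a k = ((M : ℝ) ^ n k)⁻¹) → Tendsto sch.β atTop atTop →
        Tendsto (fun k => ((M : ℝ) ^ n k) ^ 8 *
            latticeConnectedCorr r.ρ (sch.β k) (sch.side k) r.curvature.F r.curvature.F (M ^ n k))
          atTop (𝓝 θ) →
        TypicalOrbitWindowsAlongP r M sch n :=
  fun G _ _ _ _ _ _ hG r M θ sch n hM hθ hshape hβ htune =>
    stub_typicalOrbitWindows G hG r (largeFieldSparseness G r) M θ sch n hM hθ hshape hβ htune

/-- **Sub₁ from the line** (`Split.LatticeGapOnTrajectoryLat`, the pure-lattice conjunct of the landed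
decomposition p124272): stubs 1–3 through the landed plumbing `latticeGapOnTrajectoryLat_of_typical`
(DecayInterface p128295 ← `stub_decayOfTypicalWindows` p127716, `stub_gapOfDecay` p127898,
`stub_slabClusteringOfDecay` p128168). After `route edit --split LatticeGapOnTrajectory --into Lat Vol Sym`
this IS the line's composition for the child `Lat`. -/
theorem latticeGapOnTrajectoryLat_of_line : Split.LatticeGapOnTrajectoryLat :=
  latticeGapOnTrajectoryLat_of_typical stub_sparseDefectEngine typicalWindows_along

/-- **The repaired crux from the line** (`Split.LatticeGapOnTrajectoryRV` = text of
`Cruxes/LatticeGapOnTrajectory/RestatementC2.lean`): stubs 1–3 alone, through Sub₁ and the landed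
symmetric transfer (`Split.latticeGapOnTrajectoryRV_of_lat`). After a 1:1 `--restate` of (B) to RV this
IS the line's composition. -/
theorem latticeGapOnTrajectoryRV_of_line : Split.LatticeGapOnTrajectoryRV :=
  Split.latticeGapOnTrajectoryRV_of_lat latticeGapOnTrajectoryLat_of_line

/-- **The line closes the crux AS FILED** (concludes `ParabolicTrajectory.LatticeGapOnTrajectory` BY NAME,
no hypotheses; `sorry` only inside the five registered stubs): Sub₁ from stubs 1–3, the residuals (β),
(α) as stubs 4–5, glued by the landed `Split.latticeGapOnTrajectory_of_subs` (p124272). -/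
theorem LatticeGapOnTrajectory_of : LatticeGapOnTrajectory :=
  Split.latticeGapOnTrajectory_of_subs latticeGapOnTrajectoryLat_of_line stub_volume stub_symmetrise

end Summit.QuantumFields.YangMills.Cruxes.LatticeGapOnTrajectory.SparseDefectOrbitWindow

end
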